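import Literature.Probability.RandomPlanarGeometry.LoewnerTraceLimit
import Literature.Topology.PlaneTopology.HalfPlaneArc
import HarnessLib

/-!
# A simple excursion of the generating curve into its Loewner domain swallows nothing

Topic `Probability/RandomPlanarGeometry`; deterministic planar topology for Loewner chains
generated by a curve (any driving function). Let the chain driven by `W` be generated by the
curve `γ` (`Loewner.IsGeneratedByCurve`), and suppose that on a time interval `[s, s + t]` the
curve is **injective, stays in the open upper half-plane, and does not return to its past
`γ[0, s]`** (so `B = γ[s, s+t]` is a Jordan arc hanging from the tip `γ s` of the past into the
Loewner domain `Hₛ`). Then the hull does not fill in any area during `[s, s + t]`: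

* `Literature.Probability.RandomPlanarGeometry.Loewner.IsGeneratedByCurve.domain_add_eq_diff_image`
  — **`H_{s+t} = Hₛ ∖ γ[s, s+t]`**, equivalently (`hull_add_eq_union_image`)
  `K_{s+t} = Kₛ ∪ γ(s, s+t]`.

Proof: `Hₛ ∖ B` is unbounded and contained in `ℍ ∖ γ[0, s+t]`; it remains to see that it is
"connected through" the unbounded component, i.e. that any two of its points `x, y` are joined
by a connected subset of `ℍ ∖ γ[0, s+t]`. Join `x, y` by a path `P` in the open connected set
`Hₛ`, and apply **Janiszewski's theorem** (`Literature.Topology.PlaneTopology.janiszewski'`,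
Pommerenke §1.1) to the compact sets `A = γ[0, s] ∪ D⁻_R ∪ S_R` (the past, a closed lower
half-disc and a circle of radius `R` exceeding `P` and `B`) and `B`: the arc `B` meets `A`
exactly in the tip `γ s` (a connected intersection), `P` avoids `A`, and `B` separates no two
points of the plane (**arc non-separation**, `JordanArcSeparation_holds`); the connected set
produced by Janiszewski avoids the circle `S_R`, hence stays in the disc, off the lower half-disc,
hence in `ℍ`, and off `γ[0, s+t]`.

This is the topological half of the a.s. non-simplicity of the SLE_κ trace for `κ > 4`
(Rohde–Schramm (2005), §1 / Thm 6.4; Schramm (2000)): an injective trace would, right after a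
time `s` with `γ s ∈ ℍ`, make a simple excursion into `Hₛ`, so that no boundary point of `Hₛ`
could be swallowed quickly — contradicting the swallowing of real points near the driving point
in the conformal Markov picture (`LoewnerArcSwallowing.lean`, the next step).

## References

* Ch. Pommerenke, *Boundary Behaviour of Conformal Maps* (1992), §1.1 (Janiszewski's theorem).
* J. McCleary, *A First Course in Topology* (2006), Ch. 9 (arcs do not separate the plane).
* G. F. Lawler, *Conformally Invariant Processes in the Plane* (2005), §4.4 (chains generated by
  curves).
-/

noncomputable section

open Set Filter Metric Bornology Complex
open _root_.Topology
open UpperHalfPlane (upperHalfPlaneSet isOpen_upperHalfPlaneSet)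
open Literature.Topology.PlaneTopology
open scoped NNReal unitInterval

namespace Literature.Probability.RandomPlanarGeometry

namespace Loewner

variable {W : ℝ≥0 → ℝ} {γ : ℝ≥0 → ℂ}

/-! ### A piece of an injective curve is a Jordan arc -/

/-- A piece `γ[a, b]` (`a < b`) of a continuous curve injective on `[a, b]` is a Jordan arc
(homeomorphic to `[0, 1]`). [folklore] -/
theorem nonempty_homeomorph_image_Icc (hc : Continuous γ) {a b : ℝ≥0} (hab : a < b)
    (hinj : InjOn γ (Icc a b)) : Nonempty (unitInterval ≃ₜ γ '' Icc a b) := by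
  have hmem : ∀ u : I, a + unitInterval.toNNReal u * (b - a) ∈ Icc a b := fun u ↦ by
    refine ⟨le_self_add, ?_⟩
    calc a + unitInterval.toNNReal u * (b - a) ≤ a + 1 * (b - a) := by
          gcongr
          exact_mod_cast u.2.2
      _ = b := by rw [one_mul, add_tsub_cancel_of_le hab.le]
  set f : I → γ '' Icc a b := fun u ↦ ⟨γ (a + unitInterval.toNNReal u * (b - a)),
    mem_image_of_mem _ (hmem u)⟩ with hf
  have hfc : Continuous f :=
    continuous_induced_rng.2 (hc.comp (continuous_const.add
      (unitInterval.toNNReal_continuous.mul continuous_const)))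
  have hba : 0 < b - a := tsub_pos_of_lt hab
  have hfinj : Function.Injective f := by
    intro u u' h
    have h1 := hinj (hmem u) (hmem u') (congrArg Subtype.val h)
    have h2 : unitInterval.toNNReal u * (b - a) = unitInterval.toNNReal u' * (b - a) :=
      add_left_cancel h1
    exact unitInterval.toNNReal_injective (mul_right_cancel₀ hba.ne' h2)
  have hfsurj : Function.Surjective f := by
    rintro ⟨_, ⟨v, hv, rfl⟩⟩
    have hvab : ((v - a : ℝ≥0) : ℝ) / (b - a : ℝ≥0) ≤ 1 := by
      rw [div_le_one (by exact_mod_cast hba)]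
      exact_mod_cast tsub_le_tsub_right hv.2 a
    refine ⟨⟨((v - a : ℝ≥0) : ℝ) / (b - a : ℝ≥0), div_nonneg (NNReal.coe_nonneg _) (NNReal.coe_nonneg _),
      hvab⟩, Subtype.ext ?_⟩
    show γ (a + unitInterval.toNNReal ⟨((v - a : ℝ≥0) : ℝ) / (b - a : ℝ≥0), _⟩ * (b - a)) = γ v
    congr 1
    have h3 : unitInterval.toNNReal ⟨((v - a : ℝ≥0) : ℝ) / (b - a : ℝ≥0), div_nonneg
        (NNReal.coe_nonneg _) (NNReal.coe_nonneg _), hvab⟩ * (b - a) = v - a := by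
      ext
      rw [NNReal.coe_mul, unitInterval.coe_toNNReal]
      exact div_mul_cancel₀ _ (by exact_mod_cast hba.ne')
    rw [h3, add_tsub_cancel_of_le hv.1]
  exact ⟨Continuous.homeoOfEquivCompactToT2 (f := Equiv.ofBijective f ⟨hfinj, hfsurj⟩) hfc⟩

/-! ### The excursion and the domain -/

section Excursion

variable (hγ : IsGeneratedByCurve W γ) (hW : Continuous W) {s t : ℝ≥0}
include hγ hW

/-- A point of the curve after time `s` which is neither on the past `γ[0, s]` nor on the real
line lies in the Loewner domain `Hₛ` (it lies in `closure Hₛ`, `mem_closure_domain`, and the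
frontier of `Hₛ` is on `γ[0, s] ∪ ℝ`, `frontier_domain_subset`). [folklore] -/
theorem IsGeneratedByCurve.mem_domain_of_notMem {r : ℝ≥0} (hsr : s ≤ r)
    (hpast : γ r ∉ γ '' Icc 0 s) (him : 0 < (γ r).im) : γ r ∈ domain W s := by
  have hcl : γ r ∈ closure (domain W s) := hγ.mem_closure_domain hW hsr
  by_contra hnot
  have hfr : γ r ∈ frontier (domain W s) := by
    rw [frontier, (isOpen_domain hW s).interior_eq]
    exact ⟨hcl, hnot⟩
  rcases hγ.frontier_domain_subset hW s hfr with h | h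
  · exact hpast h
  · exact him.ne' h

/-- **A simple excursion into `Hₛ` swallows nothing: `H_{s+t} = Hₛ ∖ γ[s, s+t]`.** Hypotheses:
the chain of the continuous driving function `W` is generated by `γ`; on `[s, s+t]` the curve is
injective, lies in the open upper half-plane, and meets its past `γ[0, s]` only at time `s`.
Proof by Janiszewski's theorem and the non-separation of the plane by arcs (module docstring).
[folklore] -/
theorem IsGeneratedByCurve.domain_add_eq_diff_image (hinj : InjOn γ (Icc s (s + t)))
    (him : ∀ r, s ≤ r → r ≤ s + t → 0 < (γ r).im)
    (hpast : ∀ r, s < r → r ≤ s + t → γ r ∉ γ '' Icc 0 s) :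
    domain W (s + t) = domain W s \ γ '' Icc s (s + t) := by
  classical
  have hγs : γ s ∉ domain W s := fun h ↦
    (hγ.domain_subset_diff s h).2 ⟨s, ⟨bot_le, le_rfl⟩, rfl⟩
  -- the degenerate case `t = 0`
  rcases eq_or_ne t 0 with rfl | ht0
  · rw [add_zero, Icc_self, image_singleton, sdiff_singleton_eq_self hγs]
  have hst : s < s + t := lt_add_of_pos_right s (pos_iff_ne_zero.2 ht0)
  set B : Set ℂ := γ '' Icc s (s + t) with hBdef
  set A₀ : Set ℂ := γ '' Icc 0 s with hA₀def
  have hA₀c : IsCompact A₀ := hγ.isCompact_image s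
  have hBc : IsCompact B := isCompact_Icc.image hγ.continuous
  have hunion : γ '' Icc 0 (s + t) = A₀ ∪ B := by
    rw [hA₀def, hBdef, ← image_union]
    congr 1
    exact (Icc_union_Icc_eq_Icc (by positivity) le_self_add).symm
  -- (⊆)
  refine Subset.antisymm (fun z hz ↦ ⟨domain_antitone W le_self_add hz, fun hzB ↦ ?_⟩) ?_
  · have h := (hγ.domain_subset_diff (s + t) hz).2
    rw [hunion] at h
    exact h (Or.inr hzB)
  -- (⊇): `D = Hₛ ∖ B` lies in the unbounded component of `ℍ ∖ γ[0, s+t]`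
  intro x hx
  obtain ⟨hxH, hxB⟩ := hx
  set D : Set ℂ := domain W s \ B with hDdef
  have hDsub : D ⊆ upperHalfPlaneSet \ γ '' Icc 0 (s + t) := by
    rintro z ⟨hzH, hzB⟩
    refine ⟨domain_subset W s hzH, ?_⟩
    rw [hunion]
    rintro (h | h)
    · exact (hγ.domain_subset_diff s hzH).2 h
    · exact hzB h
  -- `B ∖ {γ s} ⊆ Hₛ`, `γ s ∉ Hₛ`
  have hBH : ∀ r, s < r → r ≤ s + t → γ r ∈ domain W s := fun r hsr hrt ↦
    hγ.mem_domain_of_notMem hW hsr.le (hpast r hsr hrt) (him r hsr.le hrt)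
  have hA₀B : A₀ ∩ B = {γ s} := by
    refine Subset.antisymm ?_ ?_
    · rintro p ⟨hpA, ⟨r, hr, rfl⟩⟩
      rcases hr.1.eq_or_lt with h | h
      · rw [← h]; rfl
      · exact absurd hpA (hpast r h hr.2)
    · rintro p rfl
      exact ⟨⟨s, ⟨bot_le, le_rfl⟩, rfl⟩, ⟨s, ⟨le_rfl, le_self_add⟩, rfl⟩⟩
  -- it suffices: every `y ∈ D` is joined to `x` inside `ℍ ∖ γ[0, s+t]`
  suffices key : ∀ y ∈ D, y ∈ connectedComponentIn (upperHalfPlaneSet \ γ '' Icc 0 (s + t)) x by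
    rw [hγ.domain_eq (s + t)]
    refine ⟨hDsub ⟨hxH, hxB⟩, fun hb ↦ ?_⟩
    have hDb : ¬ IsBounded D := by
      intro hDb'
      refine hγ.not_isBounded_domain s ((hDb'.union hBc.isBounded).subset fun z hz ↦ ?_)
      by_cases hzB : z ∈ B
      · exact Or.inr hzB
      · exact Or.inl ⟨hz, hzB⟩
    exact hDb (hb.subset fun y hy ↦ key y hy)
  intro y hy
  obtain ⟨hyH, hyB⟩ := hy
  -- a path from `x` to `y` in the open connected set `Hₛ`
  have hHconn : IsConnected (domain W s) := by
    rw [hγ.domain_eq s]; exact isConnected_unboundedComponent hA₀c.isBounded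
  have hHpath : IsPathConnected (domain W s) :=
    (isOpen_domain hW s).isConnected_iff_isPathConnected.1 hHconn
  obtain ⟨P, hP⟩ := hHpath.joinedIn x hxH y hyH
  set Prange : Set ℂ := range P with hPrange
  have hPc : IsCompact Prange := isCompact_range P.continuous
  have hPsub : Prange ⊆ domain W s := by
    rintro _ ⟨u, rfl⟩; exact hP u
  -- a radius `R` beyond the path and the arc
  obtain ⟨R₀, hR₀⟩ := (hPc.union hBc).isBounded.subset_closedBall 0
  set R : ℝ := |R₀| + 1 with hRdef
  have hRpos : 0 < R := by positivity
  have hnorm : ∀ z ∈ Prange ∪ B, ‖z‖ < R := fun z hz ↦ by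
    have := hR₀ hz
    rw [mem_closedBall, dist_zero_right] at this
    linarith [le_abs_self R₀]
  -- the compact set `A = γ[0,s] ∪ (lower closed half-disc) ∪ (circle)`
  set L : Set ℂ := closedBall (0 : ℂ) R ∩ {z : ℂ | z.im ≤ 0} with hLdef
  set A : Set ℂ := A₀ ∪ L ∪ sphere (0 : ℂ) R with hAdef
  have hLc : IsCompact L := (isCompact_closedBall 0 R).inter_right (isClosed_le continuous_im continuous_const)
  have hAc : IsCompact A := (hA₀c.union hLc).union (isCompact_sphere 0 R)
  -- `A ∩ B = {γ s}`
  have hBL : ∀ z ∈ B, z ∉ L := by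
    rintro _ ⟨r, hr, rfl⟩ ⟨-, hle⟩
    exact absurd hle (not_le.2 (him r hr.1 hr.2))
  have hBS : ∀ z ∈ B, z ∉ sphere (0 : ℂ) R := fun z hz hzS ↦ by
    have h1 := hnorm z (Or.inr hz)
    rw [mem_sphere, dist_zero_right] at hzS
    exact absurd hzS h1.ne
  have hAB : A ∩ B = {γ s} := by
    rw [← hA₀B]
    ext p
    simp only [hAdef, mem_inter_iff, mem_union]
    constructor
    · rintro ⟨(hpA | hpL) | hpS, hpB⟩
      · exact ⟨hpA, hpB⟩
      · exact absurd hpL (hBL p hpB)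
      · exact absurd hpS (hBS p hpB)
    · rintro ⟨hpA, hpB⟩
      exact ⟨Or.inl (Or.inl hpA), hpB⟩
  -- `x, y` are not separated by `A` (the path avoids `A`) ...
  have hPA : Prange ⊆ Aᶜ := by
    intro z hz hzA
    have hzH : z ∈ domain W s := hPsub hz
    rcases hzA with (hzA₀ | hzL) | hzS
    · exact (hγ.domain_subset_diff s hzH).2 hzA₀
    · exact absurd (show z.im ≤ 0 from hzL.2) (not_le.2 (show 0 < z.im from domain_subset W s hzH))
    · rw [mem_sphere, dist_zero_right] at hzS
      exact absurd hzS (hnorm z (Or.inl hz)).ne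
  have hxP : x ∈ Prange := ⟨0, P.source⟩
  have hyP : y ∈ Prange := ⟨1, P.target⟩
  have hSA : ∃ S ⊆ Aᶜ, IsPreconnected S ∧ x ∈ S ∧ y ∈ S :=
    ⟨Prange, hPA, (isConnected_range P.continuous).isPreconnected, hxP, hyP⟩
  -- ... nor by the arc `B` (arcs do not separate the plane)
  have hBconn : IsConnected Bᶜ :=
    JordanArcSeparation_holds B (nonempty_homeomorph_image_Icc hγ.continuous hst hinj)
  have hSB : ∃ S ⊆ Bᶜ, IsPreconnected S ∧ x ∈ S ∧ y ∈ S :=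
    ⟨Bᶜ, Subset.rfl, hBconn.isPreconnected, hxB, hyB⟩
  have hABpre : IsPreconnected (A ∩ B) := by
    rw [hAB]; exact isPreconnected_singleton
  obtain ⟨S, hS, hSc, hxS, hyS⟩ := janiszewski' hAc hBc hABpre hSA hSB
  -- `S` stays inside the disc of radius `R` (it avoids the circle and contains `x`)
  have hxR : ‖x‖ < R := hnorm x (Or.inl hxP)
  have hSball : S ⊆ ball (0 : ℂ) R := by
    have hSsub : S ⊆ ball (0 : ℂ) R ∪ (closedBall (0 : ℂ) R)ᶜ := by
      intro z hz
      have hzS : z ∉ sphere (0 : ℂ) R := fun h ↦ hS hz (Or.inl (Or.inr h))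
      rw [mem_sphere, dist_zero_right] at hzS
      rcases lt_or_gt_of_ne hzS with h | h
      · exact Or.inl (mem_ball_zero_iff.2 h)
      · refine Or.inr fun hmem ↦ ?_
        rw [mem_closedBall, dist_zero_right] at hmem
        exact absurd hmem (not_le.2 h)
    refine hSc.subset_left_of_subset_union isOpen_ball isClosed_closedBall.isOpen_compl ?_ hSsub
      ⟨x, hxS, mem_ball_zero_iff.2 hxR⟩
    exact disjoint_compl_right.mono_left ball_subset_closedBall
  -- hence in `ℍ` (off the lower half-disc) and off `γ[0, s+t]`
  have hSsub' : S ⊆ upperHalfPlaneSet \ γ '' Icc 0 (s + t) := by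
    intro z hz
    have hzball := hSball hz
    have hzA : z ∉ A ∪ B := hS hz
    refine ⟨?_, ?_⟩
    · by_contra hle
      have hle' : ¬ 0 < z.im := hle
      exact hzA (Or.inl (Or.inl (Or.inr ⟨ball_subset_closedBall hzball, not_lt.1 hle'⟩)))
    · rw [hunion]
      rintro (h | h)
      · exact hzA (Or.inl (Or.inl (Or.inl h)))
      · exact hzA (Or.inr h)
  exact hSc.subset_connectedComponentIn hxS hSsub' hyS

/-- **The hull after a simple excursion**: `K_{s+t} = Kₛ ∪ (γ[s, s+t] ∩ ℍ)` under the hypotheses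
of `domain_add_eq_diff_image`. [folklore] -/
theorem IsGeneratedByCurve.hull_add_eq_union_image (hinj : InjOn γ (Icc s (s + t)))
    (him : ∀ r, s ≤ r → r ≤ s + t → 0 < (γ r).im)
    (hpast : ∀ r, s < r → r ≤ s + t → γ r ∉ γ '' Icc 0 s) :
    hull W (s + t) = hull W s ∪ (γ '' Icc s (s + t) ∩ upperHalfPlaneSet) := by
  have h := hγ.domain_add_eq_diff_image hW hinj him hpast
  ext z
  constructor
  · intro hz
    have hzH : z ∈ upperHalfPlaneSet := hull_subset W _ hz
    by_cases hzs : z ∈ hull W s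
    · exact Or.inl hzs
    · right
      refine ⟨?_, hzH⟩
      by_contra hzB
      have hzdom : z ∈ domain W s := ⟨hzH, hzs⟩
      have : z ∈ domain W (s + t) := by rw [h]; exact ⟨hzdom, hzB⟩
      exact this.2 hz
  · rintro (hz | ⟨hzB, hzH⟩)
    · exact hull_mono W le_self_add hz
    · refine ⟨hzH, ?_⟩
      by_contra hlt
      have hzdom : z ∈ domain W (s + t) := ⟨hzH, fun hK ↦ hlt hK.2⟩
      rw [h] at hzdom
      exact hzdom.2 hzB

end Excursion

end Loewner

end Literature.Probability.RandomPlanarGeometry
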